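import Literature.NumberTheory.QuadraticFields.IdealClassEpsteinSum
import Literature.NumberTheory.QuadraticFields.EpsteinZetaKroneckerLimit
import Literature.NumberTheory.QuadraticFields.ReducedForms
import Literature.NumberTheory.QuadraticFields.BinaryQuadraticFormsRepresentation
import Literature.NumberTheory.EllipticCurves.HeegnerPointsClassNumberProofs
import Literature.NumberTheory.LFunctions.DedekindZetaProofs
import HarnessLib

/-!
# The Dedekind zeta function of an imaginary quadratic field as half the sum of the Epstein zeta
# functions of the reduced forms: `ζ_K(s) = ½ Σ_{Q reduced, disc Q = d_K} Z_Q(s)`, and `h(d_K) = h_K`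

Topic `NumberTheory/QuadraticFields`, namespace `Literature.NumberTheory.QuadraticFields.Quadratic`
(continuing `IdealClassEpsteinSum.lean`). Everything here is PROVED (theorems only, no definitions,
no named facts).

Let `K` be an imaginary quadratic field with `d_K < −4` and `(1, ω)` an integral basis,
`ω² = m + tω`, `d_K = t² + 4m`. The reduced primitive positive definite forms of discriminant `d_K`
(`Literature.NumberTheory.QuadraticFields.BinaryQuadraticForm.reducedForms`, Cox (2.7)) are a complete
irredundant system for `SL₂(ℤ)`-equivalence (Cox, Thm. 2.8: the tree's
`BinQF.exists_properEquiv_isReduced`, `BinQF.eq_of_properEquiv_of_isReduced`, transported to the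
`Γ₀(1)`-equivalence of Heegner points `IsGamma0Equiv 1` of `EllipticCurves/HeegnerPoints.lean`:
`isGamma0Equiv_one_of_properEquiv`, `properEquiv_of_isGamma0Equiv_one`), and the form-to-ideal map
`Q = (A, B, C) ↦ [𝔞_Q]`, `𝔞_Q = (A, ω − (B + t)/2)`, is a bijection onto `Cl(K)`
(`reducedForms_mk0_bijective`; well-definedness, injectivity and surjectivity are the tree's
`exists_span_mul_formIdeal_eq_of_isGamma0Equiv`, `isGamma0Equiv_of_span_mul_formIdeal_eq`,
`exists_heegnerForm_mk0_formIdeal_eq` at level `N = 1`, Gross 1984 §I.1 / Cox Thm. 7.7(ii)). Hence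

* `card_reducedForms_eq_classNumber` — **`h(d_K) = h_K`** (Cox, Thm. 7.7(ii) with Thm. 2.13);
* `dedekindZeta_eq_half_sum_epsteinZeta` — **`ζ_K(s) = ½ Σ_{Q ∈ reducedForms d_K} Z_Q(s)`** for
  `Re s > 1`, `Z_Q = Literature.Barriers.RiemannHypothesis.epsteinZeta Q.1 Q.2.1 Q.2.2`: partition
  the ideals by classes, `[𝔞] = [𝔞_Q]⁻¹` for exactly one reduced `Q`, and use the class-sum identity
  `Σ_{[𝔞]=[𝔞_Q]⁻¹} N𝔞^{−s} = ½ Z_{(A,−B,C)}(s) = ½ Z_Q(s)` (`tsum_ideal_mul_isPrincipal_eq_half_twistZeta`,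
  `epsteinZeta_neg_snd`).

This is Dirichlet's decomposition used by Granville–Stark (Invent. Math. 139 (2000), §3.2: "Selberg
and Chowla [12] … summing over the reduced forms") and by Zagier, *Zetafunktionen und quadratische
Körper*, §8 (`ζ_K(s) = Σ_A ζ(s, A)`, `ζ(s, A) = (1/w) Σ' Q_A(x,y)^{−s}`, `w = 2` for `d_K < −4`).

## References

* [Cox2013] D. A. Cox, *Primes of the form x² + ny²*, 2nd ed. (2013), Thm. 2.8, Thm. 2.13,
  §7.B Thm. 7.7.
* D. B. Zagier, *Zetafunktionen und quadratische Körper*, Springer 1981, §8.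
* [GranvilleStark2000] A. Granville, H. M. Stark, Invent. Math. 139 (2000), §3.2.
* [Gross1984] B. H. Gross, *Heegner points on `X₀(N)`*, §I.1.
-/

noncomputable section

open Module NumberField Ideal
open Literature.Barriers.RiemannHypothesis Literature.NumberTheory.QuadraticFields.BakerLimitFormula
open Literature.NumberTheory.EllipticCurves
open Literature.NumberTheory.QuadraticFields.BinaryQuadraticForm (reducedForms mem_reducedForms_iff
  isReduced_iff discr_apply)
open scoped MatrixGroups nonZeroDivisors

namespace Literature.NumberTheory.QuadraticFields.Quadratic

/-! ### Proper equivalence of forms and `Γ₀(1)`-equivalence of Heegner points -/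

/-- **Properly equivalent forms have `SL₂(ℤ)`-equivalent Heegner points**: if `g = f·M`,
`M = (p q; r s) ∈ SL₂(ℤ)`, `f` positive definite, then `τ_g = M⁻¹ · τ_f` (`sl2_smul_heegnerTau`:
`γ · τ_f = τ_{f ∘ γ⁻¹}` with `γ = M⁻¹ = (s −q; −r p)`), so `IsGamma0Equiv 1 f g`
(Cox, §7.B, proof of Thm. 7.7, (7.8); Exercise 11.5). [cite: Cox2013, §7.B Thm. 7.7 (proof, (7.8))] -/
theorem isGamma0Equiv_one_of_properEquiv {f g : BinQF} (ha : 0 < f.a) (hdisc : f.disc < 0)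
    (h : f.ProperEquiv g) : IsGamma0Equiv 1 (f.a, f.b, f.c) (g.a, g.b, g.c) := by
  obtain ⟨p, q, r, s, hdet, rfl⟩ := h
  have hfd : f.b ^ 2 - 4 * f.a * f.c < 0 := hdisc
  let γ : SL(2, ℤ) := ⟨!![s, -q; -r, p], by rw [Matrix.det_fin_two_of]; linear_combination hdet⟩
  have h00 : γ 0 0 = s := rfl
  have h01 : γ 0 1 = -q := rfl
  have h10 : γ 1 0 = -r := rfl
  have h11 : γ 1 1 = p := rfl
  have hmem : γ ∈ CongruenceSubgroup.Gamma0 1 := by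
    rw [CongruenceSubgroup.Gamma0_mem]
    exact Subsingleton.elim _ _
  refine ⟨⟨γ, hmem⟩, ?_⟩
  rw [Subgroup.mk_smul, sl2_smul_heegnerTau γ ha hfd, h00, h01, h10, h11]
  congr 1
  simp only [BinQF.act, Prod.mk.injEq]
  exact ⟨by ring, by ring, by ring⟩

/-- **`Γ₀(1)`-equivalent Heegner points come from properly equivalent forms**: if
`γ · τ_Q = τ_{Q'}` (`γ ∈ SL₂(ℤ)`; `Q, Q'` positive definite of the same discriminant) then
`Q' = Q ∘ γ⁻¹ = Q·M` with `M = γ⁻¹ ∈ SL₂(ℤ)` (`sl2_smul_heegnerTau` and `τ_Q` determines `Q`,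
`heegnerForm_eq_of_heegnerTau_eq`). [cite: Cox2013, §7.B Thm. 7.7 (proof, (7.8))] -/
theorem properEquiv_of_isGamma0Equiv_one {Q Q' : ℤ × ℤ × ℤ} (hA : 0 < Q.1)
    (hD : Q.2.1 ^ 2 - 4 * Q.1 * Q.2.2 < 0) (hA' : 0 < Q'.1)
    (hdisc : Q'.2.1 ^ 2 - 4 * Q'.1 * Q'.2.2 = Q.2.1 ^ 2 - 4 * Q.1 * Q.2.2) (h : IsGamma0Equiv 1 Q Q') :
    (BinQF.mk Q.1 Q.2.1 Q.2.2).ProperEquiv (BinQF.mk Q'.1 Q'.2.1 Q'.2.2) := by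
  obtain ⟨γ, hγ⟩ := h
  obtain ⟨A, B, C⟩ := Q
  obtain ⟨A', B', C'⟩ := Q'
  dsimp only at hA hD hA' hdisc hγ ⊢
  set g : SL(2, ℤ) := (γ : SL(2, ℤ)) with hg
  have hsmul : g • heegnerTau (A, B, C) = heegnerTau (A', B', C') := by
    rw [← hγ, hg, Subgroup.smul_def]
  rw [sl2_smul_heegnerTau g hA hD] at hsmul
  set p : ℤ := g 0 0 with hp
  set q : ℤ := g 0 1 with hq
  set r : ℤ := g 1 0 with hr
  set s : ℤ := g 1 1 with hs
  have hdet : p * s - q * r = 1 := by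
    have h := Matrix.det_fin_two (g : Matrix (Fin 2) (Fin 2) ℤ)
    rw [g.det_coe] at h
    rw [hp, hq, hr, hs]
    linarith
  have hA'' : 0 < A * s ^ 2 - B * s * r + C * r ^ 2 := sl2_act_fst_pos g hA hD
  have hdisc'' := sl2_act_disc g A B C
  have hQ := heegnerForm_eq_of_heegnerTau_eq (Q := (_, _, _)) (Q' := (A', B', C')) hA''
    (by rw [hdisc'']; exact hD) hA' (by rw [hdisc'', hdisc]) hsmul
  simp only [Prod.mk.injEq] at hQ
  obtain ⟨hA1, hB1, hC1⟩ := hQ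
  refine ⟨s, -q, -r, p, by linear_combination hdet, ?_⟩
  simp only [BinQF.act, BinQF.mk.injEq]
  exact ⟨by rw [← hA1]; ring, by rw [← hB1]; ring, by rw [← hC1]; ring⟩

/-! ### Reduced forms are a complete irredundant system for `Γ₀(1)`-equivalence -/

/-- **Every form of discriminant `D < 0` (level `1`) is `Γ₀(1)`-equivalent to a reduced form**
(Cox, Thm. 2.8, existence: `BinQF.exists_properEquiv_isReduced`). [cite: Cox2013, Thm. 2.8] -/
theorem exists_mem_reducedForms_isGamma0Equiv {D : ℤ} (hD : D < 0) {Q : ℤ × ℤ × ℤ}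
    (hQ : Q ∈ heegnerForms 1 D) : ∃ Q' ∈ reducedForms D, IsGamma0Equiv 1 Q Q' := by
  obtain ⟨hdisc, hA, -, hprim⟩ := hQ
  set f : BinQF := ⟨Q.1, Q.2.1, Q.2.2⟩ with hf
  have hfpp : f.IsPosPrim D := ⟨hdisc, hA, (BinQF.isPrimitive_iff f).2 hprim⟩
  obtain ⟨g, hfg, hred⟩ := BinQF.exists_properEquiv_isReduced hD hfpp
  have hg : g.IsPosPrim D := hfg.isPosPrim hD hfpp
  refine ⟨(g.a, g.b, g.c), ?_, ?_⟩
  · rw [mem_reducedForms_iff hD]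
    refine ⟨hg.disc_eq, hg.a_pos, ?_, (isReduced_iff g.a g.b g.c).2 hred⟩
    exact hg.primitive
  · have hfd : f.disc < 0 := by rw [hfpp.disc_eq]; exact hD
    exact isGamma0Equiv_one_of_properEquiv (f := f) hA hfd hfg

/-- **Distinct reduced forms are not `Γ₀(1)`-equivalent** (Cox, Thm. 2.8, uniqueness:
`BinQF.eq_of_properEquiv_of_isReduced`). [cite: Cox2013, Thm. 2.8] -/
theorem eq_of_mem_reducedForms_of_isGamma0Equiv {D : ℤ} (hD : D < 0) {Q Q' : ℤ × ℤ × ℤ}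
    (hQ : Q ∈ reducedForms D) (hQ' : Q' ∈ reducedForms D) (h : IsGamma0Equiv 1 Q Q') : Q = Q' := by
  obtain ⟨hd, hA, hprim, hred⟩ := (mem_reducedForms_iff hD).1 hQ
  obtain ⟨hd', hA', hprim', hred'⟩ := (mem_reducedForms_iff hD).1 hQ'
  have hdQ : Q.2.1 ^ 2 - 4 * Q.1 * Q.2.2 = D := hd
  have hdQ' : Q'.2.1 ^ 2 - 4 * Q'.1 * Q'.2.2 = D := hd'
  have hpe := properEquiv_of_isGamma0Equiv_one hA (by rw [hdQ]; exact hD) hA' (by rw [hdQ, hdQ']) h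
  have hf : (BinQF.mk Q.1 Q.2.1 Q.2.2).IsPosPrim D := ⟨hdQ, hA, hprim⟩
  have hg : (BinQF.mk Q'.1 Q'.2.1 Q'.2.2).IsPosPrim D := ⟨hdQ', hA', hprim'⟩
  have heq := BinQF.eq_of_properEquiv_of_isReduced hf hg
    ((isReduced_iff Q.1 Q.2.1 Q.2.2).1 hred) ((isReduced_iff Q'.1 Q'.2.1 Q'.2.2).1 hred') hpe
  simp only [BinQF.mk.injEq] at heq
  obtain ⟨h1, h2, h3⟩ := heq
  exact Prod.ext h1 (Prod.ext h2 h3)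

/-- Two forms of the same discriminant have `B ≡ B' (mod 2)`. [folklore] -/
theorem snd_modEq_two_of_discr_eq {Q Q' : ℤ × ℤ × ℤ} {D : ℤ}
    (hd : Q.2.1 ^ 2 - 4 * Q.1 * Q.2.2 = D) (hd' : Q'.2.1 ^ 2 - 4 * Q'.1 * Q'.2.2 = D) :
    Q.2.1 ≡ Q'.2.1 [ZMOD 2 * (1 : ℕ)] := by
  rw [Int.ModEq, Nat.cast_one, mul_one]
  have e : Q.2.1 ^ 2 - Q'.2.1 ^ 2 = 4 * (Q.1 * Q.2.2 - Q'.1 * Q'.2.2) := by linear_combination hd - hd'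
  have h2 : (2 : ℤ) ∣ (Q.2.1 - Q'.2.1) * (Q.2.1 + Q'.2.1) := by
    rw [show (Q.2.1 - Q'.2.1) * (Q.2.1 + Q'.2.1) = Q.2.1 ^ 2 - Q'.2.1 ^ 2 by ring, e]
    exact Dvd.dvd.mul_right (by norm_num) _
  rcases Int.prime_two.dvd_or_dvd h2 with h | h <;> omega

/-! ### The bijection `reducedForms d_K ≃ Cl(K)` -/

section ClassGroup

variable {K : Type*} [Field K] [NumberField K]

omit [NumberField K] in
/-- The ideal `𝔞_Q = (A, ω − (B + t)/2)` of a reduced form is a non-zero-divisor. [folklore] -/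
theorem formIdeal_mem_nonZeroDivisors (b : Basis (Fin 2) ℤ (𝓞 K)) (hb : b 0 = 1) {t m : ℤ}
    (hneg : t ^ 2 + 4 * m < 0) (Q : reducedForms (t ^ 2 + 4 * m)) :
    Ideal.span {((Q : ℤ × ℤ × ℤ).1 : 𝓞 K), b 1 - ((((Q : ℤ × ℤ × ℤ).2.1 + t) / 2 : ℤ) : 𝓞 K)} ∈
      (Ideal (𝓞 K))⁰ :=
  span_pair_mem_nonZeroDivisors b hb ((mem_reducedForms_iff hneg).1 Q.2).2.1.ne' _

/-- A reduced form of discriminant `t² + 4m` is a Heegner form of level `1`. [folklore] -/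
theorem mem_heegnerForms_one_of_mem_reducedForms {t m : ℤ} (hneg : t ^ 2 + 4 * m < 0)
    {Q : ℤ × ℤ × ℤ} (hQ : Q ∈ reducedForms (t ^ 2 + 4 * m)) : Q ∈ heegnerForms 1 (t ^ 2 + 4 * m) := by
  obtain ⟨hdisc, hpos, hprim, -⟩ := (mem_reducedForms_iff hneg).1 hQ
  exact ⟨hdisc, hpos, one_dvd _, (BinQF.isPrimitive_iff ⟨Q.1, Q.2.1, Q.2.2⟩).1 hprim⟩

/-- **`reducedForms d_K ≃ Cl(K)`: the map `Q = (A, B, C) ↦ [𝔞_Q]`, `𝔞_Q = (A, ω − (B + t)/2)`, is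
a bijection from the reduced forms of discriminant `d_K = t² + 4m` onto the class group** (Cox,
Thm. 7.7(ii): `C(d_K) ≅ C(𝒪_K)`, with Thm. 2.8/2.13: classes of forms ↔ reduced forms). Injective:
equal classes give `Γ₀(1)`-equivalent forms (`isGamma0Equiv_of_span_mul_formIdeal_eq`), and
`Γ₀(1)`-equivalent reduced forms are equal; surjective: every class contains some `𝔞_{Q₀}`
(`exists_heegnerForm_mk0_formIdeal_eq`), `Q₀ ∼ Q₁` reduced, and equivalent forms give the same class
(`exists_span_mul_formIdeal_eq_of_isGamma0Equiv`). [cite: Cox2013, §7.B Thm. 7.7(ii)] -/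
theorem reducedForms_mk0_bijective (b : Basis (Fin 2) ℤ (𝓞 K)) (hb : b 0 = 1) {t m : ℤ}
    (hω : b 1 * b 1 = (m : 𝓞 K) + (t : 𝓞 K) * b 1) (hneg : t ^ 2 + 4 * m < 0) :
    Function.Bijective (fun Q : reducedForms (t ^ 2 + 4 * m) =>
      ClassGroup.mk0 ⟨_, formIdeal_mem_nonZeroDivisors b hb hneg Q⟩) := by
  classical
  set D := t ^ 2 + 4 * m with hDdef
  constructor
  · rintro ⟨Q₁, h₁⟩ ⟨Q₂, h₂⟩ heq
    obtain ⟨x, y, hx, -, hxy⟩ := ClassGroup.mk0_eq_mk0_iff.mp heq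
    have hQ₁ := mem_heegnerForms_one_of_mem_reducedForms hneg h₁
    have hQ₂ := mem_heegnerForms_one_of_mem_reducedForms hneg h₂
    have hequiv : IsGamma0Equiv 1 Q₁ Q₂ :=
      isGamma0Equiv_of_span_mul_formIdeal_eq b hb hω hneg hQ₁ hQ₂
        (snd_modEq_two_of_discr_eq hQ₁.1 hQ₂.1) hx hxy
    exact Subtype.ext (eq_of_mem_reducedForms_of_isGamma0Equiv hneg h₁ h₂ hequiv)
  · intro c
    have hβ : (4 * (1 : ℕ) : ℤ) ∣ t ^ 2 - (t ^ 2 + 4 * m) := ⟨-m, by push_cast; ring⟩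
    obtain ⟨Q₀, hQ₀, -, h00, hc⟩ := exists_heegnerForm_mk0_formIdeal_eq b hb hω hneg hβ c
    obtain ⟨Q₁, hQ₁, heqv⟩ := exists_mem_reducedForms_isGamma0Equiv hneg hQ₀
    refine ⟨⟨Q₁, hQ₁⟩, ?_⟩
    obtain ⟨hd₀, hA₀, -, -⟩ := hQ₀
    obtain ⟨hd₁, hA₁, -, -⟩ := (mem_reducedForms_iff hneg).1 hQ₁
    obtain ⟨x, y, hx, hy, hxy⟩ :=
      exists_span_mul_formIdeal_eq_of_isGamma0Equiv b hb hω hneg hA₀ hd₀ hA₁ hd₁ heqv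
    rw [← hc]
    exact ClassGroup.mk0_eq_mk0_iff.mpr ⟨y, x, hy, hx, hxy.symm⟩

/-- **`h(d_K) = h_K`** (coordinates): the number of reduced forms of discriminant `t² + 4m = d_K` is
the class number of `K`. [cite: Cox2013, §7.B Thm. 7.7(ii)] -/
theorem card_reducedForms_eq_classNumber' (b : Basis (Fin 2) ℤ (𝓞 K)) (hb : b 0 = 1) {t m : ℤ}
    (hω : b 1 * b 1 = (m : 𝓞 K) + (t : 𝓞 K) * b 1) (hneg : t ^ 2 + 4 * m < 0) :
    (reducedForms (t ^ 2 + 4 * m)).card = NumberField.classNumber K := by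
  classical
  have h := Fintype.card_of_bijective (reducedForms_mk0_bijective b hb hω hneg)
  rw [Fintype.card_coe] at h
  rw [h]
  rfl

/-- **`h(d_K) = h_K`**: for an imaginary quadratic field `K`, the form class number of the
fundamental discriminant `d_K` (`BinaryQuadraticForm.classNumber`, the number of reduced primitive
positive definite forms, Cox Thm. 2.13) is Mathlib's `NumberField.classNumber K` (Cox, Thm. 7.7(ii):
`C(d_K) ≅ C(𝒪_K)`). [cite: Cox2013, §7.B Thm. 7.7(ii)] -/
theorem card_reducedForms_eq_classNumber (h2 : finrank ℚ K = 2) (hd : NumberField.discr K < 0) :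
    BinaryQuadraticForm.classNumber (NumberField.discr K) = NumberField.classNumber K := by
  obtain ⟨b, hb⟩ := exists_basis_zero_eq_one h2
  have hω := basis_one_mul_self_eq b hb
  have hD := discr_eq_sq_add_four_mul b hb
  have hneg : (b.repr (b 1 * b 1) 1) ^ 2 + 4 * b.repr (b 1 * b 1) 0 < 0 := hD ▸ hd
  rw [BinaryQuadraticForm.classNumber, hD]
  exact card_reducedForms_eq_classNumber' b hb hω hneg

end ClassGroup

/-! ### `ζ_K(s) = ½ Σ_{Q reduced} Z_Q(s)` -/

/-- The Epstein zeta function is unchanged by `b ↦ −b` (substitute `y ↦ −y`). [folklore] -/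
theorem epsteinZeta_neg_snd (a b c : ℝ) (s : ℂ) : epsteinZeta a (-b) c s = epsteinZeta a b c s := by
  unfold epsteinZeta
  rw [← (Equiv.prodCongr (Equiv.refl ℤ) (Equiv.neg ℤ)).tsum_eq (epsteinTerm a (-b) c s)]
  refine tsum_congr fun p => ?_
  obtain ⟨x, y⟩ := p
  simp only [Equiv.prodCongr_apply, Equiv.coe_refl, Prod.map_apply, id_eq, Equiv.neg_apply,
    epsteinTerm]
  have h0 : ((x, -y) : ℤ × ℤ) = 0 ↔ ((x, y) : ℤ × ℤ) = 0 := by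
    simp [Prod.ext_iff]
  by_cases hp : ((x, y) : ℤ × ℤ) = 0
  · rw [if_pos (h0.2 hp), if_pos hp]
  · rw [if_neg (fun h => hp (h0.1 h)), if_neg hp]
    congr 2
    unfold bqfEval
    push_cast
    ring

/-- A Dirichlet character mod `1` is identically `1`. [folklore] -/
theorem dirichletCharacter_one_apply (ψ : DirichletCharacter ℂ 1) (a : ZMod 1) : ψ a = 1 := by
  rw [Subsingleton.elim a 1, map_one]

section Zeta

variable {K : Type*} [Field K] [NumberField K]

/-- **The class sum of a reduced form, untwisted**: for `Q = (A, B, C)` reduced of discriminant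
`t² + 4m = d_K < −4` and `Re s > 1`,
`Σ_{𝔞 : 𝔞_Q 𝔞 principal} N𝔞^{−s} = ½ Z_Q(s)` (`tsum_ideal_mul_isPrincipal_eq_half_twistZeta` with the
trivial character, `Z_{(A,−B,C)} = Z_{(A,B,C)}`). [cite: Cox2013, §7.B Thm. 7.7] -/
theorem tsum_ideal_mul_isPrincipal_eq_half_epsteinZeta (b : Basis (Fin 2) ℤ (𝓞 K)) (hb : b 0 = 1)
    {t m : ℤ} (hω : b 1 * b 1 = (m : 𝓞 K) + (t : 𝓞 K) * b 1) (hD : t ^ 2 + 4 * m < -4)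
    {Q : ℤ × ℤ × ℤ} (hQ : Q ∈ reducedForms (t ^ 2 + 4 * m)) {s : ℂ} (hs : 1 < s.re) :
    ∑' J : {J : Ideal (𝓞 K) //
        (span {(Q.1 : 𝓞 K), b 1 - (((Q.2.1 + t) / 2 : ℤ) : 𝓞 K)} * J).IsPrincipal},
        ((absNorm J.1 : ℕ) : ℂ) ^ (-s) =
      1 / 2 * epsteinZeta (Q.1 : ℝ) (Q.2.1 : ℝ) (Q.2.2 : ℝ) s := by
  have hneg : t ^ 2 + 4 * m < 0 := by linarith
  obtain ⟨hdisc, hA, -, -⟩ := (mem_reducedForms_iff hneg).1 hQ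
  have hd : Q.2.1 ^ 2 - 4 * Q.1 * Q.2.2 = t ^ 2 + 4 * m := hdisc
  set k : ℤ := (Q.2.1 + t) / 2 with hk
  have h2k : 2 * k = Q.2.1 + t := two_mul_ediv_two_of_disc_eq hd
  have hn : Q.1 * Q.2.2 = k ^ 2 - t * k - m := norm_eq_of_disc_eq hd h2k
  have h := tsum_ideal_mul_isPrincipal_eq_half_twistZeta b hb hω hD hA hn
    (1 : DirichletCharacter ℂ 1) hs
  simp only [dirichletCharacter_one_apply, one_mul] at h
  rw [h, KroneckerLimit.twistZeta_one, show ((t - 2 * k : ℤ) : ℝ) = -(Q.2.1 : ℝ) by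
    have : t - 2 * k = -Q.2.1 := by linarith
    rw [this]; push_cast; ring, epsteinZeta_neg_snd]

/-- **`ζ_K(s) = ½ Σ_{Q reduced of discriminant d_K} Z_Q(s)`** for an imaginary quadratic field `K`
with `d_K < −4` and `Re s > 1` (coordinates `d_K = t² + 4m`): the ideals `𝔞 ≠ 0` are partitioned by
their classes, `[𝔞] = [𝔞_Q]⁻¹` for a unique reduced `Q` (`reducedForms_mk0_bijective`,
`ClassGroup.mk0_eq_mk0_inv_iff`), and each class sum is `½ Z_Q(s)`
(`tsum_ideal_mul_isPrincipal_eq_half_epsteinZeta`); Mathlib's `NumberField.dedekindZeta` is the sum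
over all ideals (`Literature.NumberTheory.LFunctions.hasSum_absNorm_cpow`). Zagier §8; Granville–Stark
§3.2. [cite: GranvilleStark2000, §3.2] -/
theorem dedekindZeta_eq_half_sum_epsteinZeta' (b : Basis (Fin 2) ℤ (𝓞 K)) (hb : b 0 = 1)
    {t m : ℤ} (hω : b 1 * b 1 = (m : 𝓞 K) + (t : 𝓞 K) * b 1) (hD : t ^ 2 + 4 * m < -4)
    {s : ℂ} (hs : 1 < s.re) :
    NumberField.dedekindZeta K s = 1 / 2 * ∑ Q ∈ reducedForms (t ^ 2 + 4 * m),
      epsteinZeta (Q.1 : ℝ) (Q.2.1 : ℝ) (Q.2.2 : ℝ) s := by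
  classical
  have hneg : t ^ 2 + 4 * m < 0 := by linarith
  have hs0 : -s ≠ 0 := neg_ne_zero.mpr fun h => by rw [h, Complex.zero_re] at hs; linarith
  set D := t ^ 2 + 4 * m with hDdef
  -- the ideal of a form and the summand
  set 𝔞 : ℤ × ℤ × ℤ → Ideal (𝓞 K) := fun Q =>
    span {(Q.1 : 𝓞 K), b 1 - (((Q.2.1 + t) / 2 : ℤ) : 𝓞 K)} with h𝔞
  set G : Ideal (𝓞 K) → ℂ := fun I => ((absNorm I : ℕ) : ℂ) ^ (-s) with hG
  have hGsum : Summable G := (Literature.NumberTheory.LFunctions.summable_norm_absNorm_cpow K hs).of_norm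
  have hζ : NumberField.dedekindZeta K s = ∑' I : Ideal (𝓞 K), G I :=
    (Literature.NumberTheory.LFunctions.hasSum_absNorm_cpow K hs).tsum_eq.symm
  -- the bijection with the class group
  have hbij := reducedForms_mk0_bijective b hb hω hneg
  set Ψ : reducedForms D → _root_.ClassGroup (𝓞 K) := fun Q =>
    ClassGroup.mk0 ⟨_, formIdeal_mem_nonZeroDivisors b hb hneg Q⟩ with hΨ
  -- pointwise: `G I = Σ_Q [𝔞_Q I principal] G I`
  have hpt : ∀ I : Ideal (𝓞 K),
      G I = ∑ Q ∈ reducedForms D, Set.indicator {I | (𝔞 Q * I).IsPrincipal} G I := by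
    intro I
    by_cases hI : I = ⊥
    · -- both sides vanish
      have hG0 : G I = 0 := by
        rw [hG, hI]
        simp only [Ideal.absNorm_bot, Nat.cast_zero, Complex.zero_cpow hs0]
      rw [hG0]
      refine (Finset.sum_eq_zero fun Q _ => ?_).symm
      by_cases hmem : I ∈ {I | (𝔞 Q * I).IsPrincipal}
      · rw [Set.indicator_of_mem hmem, hG0]
      · rw [Set.indicator_of_notMem hmem]
    · -- exactly one reduced `Q` has `𝔞_Q I` principal: the one with `[𝔞_Q] = [I]⁻¹`
      have hI0 : I ∈ (Ideal (𝓞 K))⁰ := mem_nonZeroDivisors_of_ne_zero hI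
      have hiff : ∀ Q : reducedForms D,
          (𝔞 Q * I).IsPrincipal ↔ Ψ Q = (ClassGroup.mk0 ⟨I, hI0⟩)⁻¹ := by
        intro Q
        rw [hΨ, ClassGroup.mk0_eq_mk0_inv_iff, Submodule.isPrincipal_iff]
        simp only
        constructor
        · rintro ⟨x, hx⟩
          refine ⟨x, ?_, hx⟩
          rintro rfl
          rw [Submodule.span_zero_singleton] at hx
          exact (mul_ne_zero (nonZeroDivisors.ne_zero (formIdeal_mem_nonZeroDivisors b hb hneg Q)) hI) hx
        · rintro ⟨x, -, hx⟩
          exact ⟨x, hx⟩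
      obtain ⟨Q₀, hQ₀, huniq⟩ : ∃! Q : reducedForms D, Ψ Q = (ClassGroup.mk0 ⟨I, hI0⟩)⁻¹ :=
        (Function.bijective_iff_existsUnique Ψ).1 hbij _
      rw [Finset.sum_eq_single (Q₀ : ℤ × ℤ × ℤ)]
      · rw [Set.indicator_of_mem]
        exact (hiff Q₀).2 hQ₀
      · intro Q hQ hne
        rw [Set.indicator_of_notMem]
        intro hmem
        have h1 := (hiff ⟨Q, hQ⟩).1 hmem
        exact hne (congrArg Subtype.val (huniq ⟨Q, hQ⟩ h1))
      · intro h
        exact absurd Q₀.2 h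
  -- sum over `I`, then interchange
  have hind : ∀ Q ∈ reducedForms D, Summable (Set.indicator {I | (𝔞 Q * I).IsPrincipal} G) :=
    fun Q _ => hGsum.indicator _
  rw [hζ, tsum_congr hpt, Summable.tsum_finsetSum hind, Finset.mul_sum]
  refine Finset.sum_congr rfl fun Q hQ => ?_
  rw [← tsum_subtype, ← tsum_ideal_mul_isPrincipal_eq_half_epsteinZeta b hb hω hD hQ hs]
  rfl

/-- **`ζ_K(s) = ½ Σ_{Q ∈ reducedForms d_K} Z_Q(s)`** for an imaginary quadratic field with `d_K < −4`
and `Re s > 1` (Dirichlet; Zagier §8; Granville–Stark §3.2). [cite: GranvilleStark2000, §3.2] -/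
theorem dedekindZeta_eq_half_sum_epsteinZeta (h2 : finrank ℚ K = 2) (hd : NumberField.discr K < -4)
    {s : ℂ} (hs : 1 < s.re) :
    NumberField.dedekindZeta K s = 1 / 2 * ∑ Q ∈ reducedForms (NumberField.discr K),
      epsteinZeta (Q.1 : ℝ) (Q.2.1 : ℝ) (Q.2.2 : ℝ) s := by
  obtain ⟨b, hb⟩ := exists_basis_zero_eq_one h2
  have hω := basis_one_mul_self_eq b hb
  have hD := discr_eq_sq_add_four_mul b hb
  have hneg : (b.repr (b 1 * b 1) 1) ^ 2 + 4 * b.repr (b 1 * b 1) 0 < -4 := hD ▸ hd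
  rw [hD]
  exact dedekindZeta_eq_half_sum_epsteinZeta' b hb hω hneg hs

end Zeta

end Literature.NumberTheory.QuadraticFields.Quadratic
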